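import Summits.QuantumAdvantage.AdviceFreeQNC0.WalkTransport
import Mathlib.Data.Fin.Tuple.Basic
import HarnessLib

/-!
# Lemma J_m — HIDDEN COINS, part 1/2: the free-phase oblivious game `G_m`, `ω(4) = 3/4` kernel-checked with the standard
# axioms, and the statements `HiddenCoinsBound / HiddenCoinsReduction / HiddenCoinsFour` (planner qa-qnc0-p2 g20, ROUND-20 (p2) §2; ask P2-20a)

Planner qa-qnc0-p2 g20's `line20/Sketch20.lean` §FreePhase and the defs `HiddenCoinsBound / HiddenCoinsReduction /
HiddenCoinsFour` (+ the bookkeeping `hiddenCoinsBound_mono`, `hiddenCoinsFour_of`) are repeated VERBATIM; new here is the proof of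

* `FreePhase.bound_four : FreePhase.Bound 4 12` — the value `ω(4) = 3/4` of the free-phase oblivious game `G_4`, by kernel
  evaluation with the STANDARD axioms (no `native_decide`): the `4⁵` phase vectors and `2⁴` coin patterns are enumerated
  structurally (`FreePhase.allPhases`, `FreePhase.countCoins`, by `Fin.cons`; `forall_of_allPhases`, `countCoins_eq`) and
  `decide +kernel` evaluates the verbatim `win` (≈ 15 s on the farm).

Part 2 (`HiddenCoinsReduction.lean`) proves `hiddenCoinsReduction : HiddenCoinsReduction` (the fibre reduction) and
`hiddenCoinsFour : HiddenCoinsFour` (= item stmt-QuantumAdvantage-27289 `HiddenCoinsFourOdd`).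
PLACEMENT (qn-lit g26, L-20(a)): J_m is the locality-0 case of the standard restriction step [WKST19 Thm 8 (d fixed bits);
BGK18 Lemma 3; cf. ISMR arXiv:2408.16378 L53 (r restricted dits)] for α's u-walk relation; unlike PHP/GHZ/ISMR, whose restricted
values decay to the trivial value, the u-walk's decays to its oblivious optimum `2/3`, with excess halving per hidden coin; the
finite game `G_m` and `ω(m) = (⌊2^{m+1}/3⌋+2)/2^m` (exhaustive, `2 ≤ m ≤ 10`, planner's `line20/omega.py`, re-run by qa-qnc0-ref
g67 R-20 (ii)) are new.  `FreePhase.Sharp` (all `m`) stays a conjecture (def only); the planner's `bound_six : Bound 6 44`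
(`native_decide`, compiler-trust axiom) is not landed here.
WHAT THIS IS NOT: rung F-Q2-odd instrument; separation NOT moved.
-/

namespace Summit.QuantumAdvantage.AdviceFreeQNC0

open Finset

namespace FreePhase

/-- Walk value seen at position `j ∈ {0,…,m}` of the free-phase game on hidden coins `x`:
`wt x + #{i < j : x i}` in `ZMod 3` (the invisible part of `walkExp u g` for a cut preceded by exactly `j` hidden coins). -/
def V (m : ℕ) (x : Fin m → Bool) (j : Fin (m + 1)) : ZMod 3 :=
  ((univ.filter fun i : Fin m => x i = true).card : ZMod 3) +
    ((univ.filter fun i : Fin m => x i = true ∧ i.val < j.val).card : ZMod 3)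

/-- The contribution of position `j` under phase choice `φ j`: nothing, or the indicator `[V_j(x) ≠ a]`. -/
def live (m : ℕ) (φ : Fin (m + 1) → Option (ZMod 3)) (x : Fin m → Bool) (j : Fin (m + 1)) : Bool :=
  match φ j with
  | none => false
  | some a => decide (V m x j ≠ a)

/-- A free-phase strategy `φ` wins on `x` iff an odd number of positions contribute. -/
def win (m : ℕ) (φ : Fin (m + 1) → Option (ZMod 3)) (x : Fin m → Bool) : Bool :=
  (univ.filter fun j : Fin (m + 1) => live m φ x j = true).card % 2 == 1

/-- `Bound m k`: every free-phase strategy on `m` hidden coins wins on at most `k` of the `2^m` coin patterns. -/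
def Bound (m k : ℕ) : Prop :=
  ∀ φ : Fin (m + 1) → Option (ZMod 3), (univ.filter fun x : Fin m → Bool => win m φ x = true).card ≤ k

/-- Conjectured sharp value (verified for 2 ≤ m ≤ 10 by exhaustive search): `⌊2^{m+1}/3⌋ + 2` winning patterns,
i.e. win probability `2/3 + (4 + [m odd])/(3·2^m)`. -/
def Sharp : Prop := ∀ m : ℕ, 2 ≤ m → Bound m (2 ^ (m + 1) / 3 + 2)

/-! ### Kernel evaluation of `Bound 4 12` with the standard axioms: structural enumeration by `Fin.cons` -/

/-- Conjunction of a Boolean test over ALL phase vectors `Fin L → Option (ZMod 3)`, enumerated by `Fin.cons`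
(kernel-reducible; avoids the `Fintype` instance of the function space). -/
def allPhases : (L : ℕ) → ((Fin L → Option (ZMod 3)) → Bool) → Bool
  | 0, P => P fun i => i.elim0
  | L + 1, P =>
      allPhases L (fun ψ => P (Fin.cons (α := fun _ => Option (ZMod 3)) none ψ)) &&
        (allPhases L (fun ψ => P (Fin.cons (α := fun _ => Option (ZMod 3)) (some 0) ψ)) &&
          (allPhases L (fun ψ => P (Fin.cons (α := fun _ => Option (ZMod 3)) (some 1) ψ)) &&
            allPhases L (fun ψ => P (Fin.cons (α := fun _ => Option (ZMod 3)) (some 2) ψ))))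

/-- The four phase options. -/
private theorem option_zmod3_cases (o : Option (ZMod 3)) : o = none ∨ o = some 0 ∨ o = some 1 ∨ o = some 2 := by
  revert o; decide

/-- `allPhases L P` certifies `P` on every phase vector. -/
theorem forall_of_allPhases : ∀ (L : ℕ) (P : (Fin L → Option (ZMod 3)) → Bool), allPhases L P = true →
    ∀ φ : Fin L → Option (ZMod 3), P φ = true
  | 0, P, h, φ => by
      have e : φ = fun i => i.elim0 := funext fun i => i.elim0
      rw [e]; exact h
  | L + 1, P, h, φ => by
      simp only [allPhases, Bool.and_eq_true] at h
      obtain ⟨h0, h1, h2, h3⟩ := h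
      rw [← Fin.cons_self_tail φ]
      rcases option_zmod3_cases (φ 0) with e | e | e | e <;> rw [e]
      · exact forall_of_allPhases L _ h0 (Fin.tail φ)
      · exact forall_of_allPhases L _ h1 (Fin.tail φ)
      · exact forall_of_allPhases L _ h2 (Fin.tail φ)
      · exact forall_of_allPhases L _ h3 (Fin.tail φ)

/-- Number of coin patterns `Fin m → Bool` passing a Boolean test, enumerated by `Fin.cons` (kernel-reducible). -/
def countCoins : (m : ℕ) → ((Fin m → Bool) → Bool) → ℕ
  | 0, P => if P (fun i => i.elim0) = true then 1 else 0
  | m + 1, P =>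
      countCoins m (fun x => P (Fin.cons (α := fun _ => Bool) false x)) +
        countCoins m (fun x => P (Fin.cons (α := fun _ => Bool) true x))

/-- One slice of the pattern cube: the patterns with prescribed first coin `b` passing `P` are the `Fin.cons b`-image of
the patterns of one dimension less passing `P ∘ Fin.cons b`. -/
private theorem card_filter_cons_eq (m : ℕ) (P : (Fin (m + 1) → Bool) → Bool) (b : Bool) :
    ((univ.filter fun x : Fin (m + 1) → Bool => P x = true).filter fun x => x 0 = b).card =
      (univ.filter fun x : Fin m → Bool => P (Fin.cons (α := fun _ => Bool) b x) = true).card := by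
  rw [← Finset.card_image_of_injective
    (univ.filter fun x : Fin m → Bool => P (Fin.cons (α := fun _ => Bool) b x) = true)
    (Fin.cons_right_injective (α := fun _ => Bool) b)]
  congr 1
  ext x
  simp only [mem_filter, mem_univ, true_and, Finset.mem_image]
  constructor
  · rintro ⟨hP, hx⟩
    refine ⟨Fin.tail x, ?_, ?_⟩
    · have e : Fin.cons (α := fun _ => Bool) b (Fin.tail x) = x := by
        rw [← hx]; exact Fin.cons_self_tail x
      rw [e]; exact hP
    · rw [← hx]; exact Fin.cons_self_tail x
  · rintro ⟨y, hy, rfl⟩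
    exact ⟨hy, rfl⟩

/-- `countCoins` computes the number of patterns passing the test. -/
theorem countCoins_eq : ∀ (m : ℕ) (P : (Fin m → Bool) → Bool),
    countCoins m P = (univ.filter fun x : Fin m → Bool => P x = true).card
  | 0, P => by
      have hu : (univ : Finset (Fin 0 → Bool)) = {fun i => i.elim0} := by
        rw [Finset.univ_unique]
        exact congrArg _ (Subsingleton.elim _ _)
      rw [countCoins, hu, Finset.filter_singleton]
      split_ifs <;> simp
  | m + 1, P => by
      rw [countCoins, countCoins_eq m, countCoins_eq m,
        ← Finset.card_filter_add_card_filter_not (fun x : Fin (m + 1) → Bool => x 0 = false),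
        card_filter_cons_eq m P false]
      congr 1
      rw [← card_filter_cons_eq m P true]
      congr 1
      refine filter_congr fun x _ => ?_
      cases x 0 <;> simp

/-- ω(4) = 3/4: kernel-checked by evaluation (4⁵ strategies × 16 patterns), standard axioms only. -/
theorem bound_four : Bound 4 12 := by
  have h : allPhases 5 (fun φ => decide (countCoins 4 (fun x => win 4 φ x) ≤ 12)) = true := by
    decide +kernel
  intro φ
  have hφ := forall_of_allPhases 5 _ h φ
  rw [decide_eq_true_eq, countCoins_eq] at hφ
  exact hφ

end FreePhase

/-- **Lemma J_m (hidden coins).** `HiddenCoinsBound m θ`: every strategy all of whose cuts read only a common set `J`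
of input bits with `|J| + m ≤ n` (arbitrary tables, arbitrary complexity) wins α's u-walk game `ringWinU c` on at most
`θ·2ⁿ` inputs. -/
def HiddenCoinsBound (m : ℕ) (θ : ℝ) : Prop :=
  ∀ n c : ℕ, ∀ J : Finset (Fin n), J.card + m ≤ n → ∀ y : Fin (n + 1) → (Fin n → Bool) → Bool,
    (∀ g, ∀ u v : Fin n → Bool, (∀ i ∈ J, u i = v i) → y g u = y g v) →
      ((univ.filter fun u : Fin n → Bool => ringWinU c y u = true).card : ℝ) ≤ θ * (2 : ℝ) ^ n

/-- The fibre reduction (support, size M): on each fibre `{u : u|_{Jᶜ-complement of m coins} fixed}` the fired set is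
constant and `walkExp u g = t_g + V_{j(g)}(x)`, so the play is a free-phase strategy of `G_m`. -/
def HiddenCoinsReduction : Prop :=
  ∀ m k : ℕ, FreePhase.Bound m k → HiddenCoinsBound m ((k : ℝ) / (2 : ℝ) ^ m)

/-- J_4: four common hidden coordinates cap the win probability at 3/4. -/
def HiddenCoinsFour : Prop := HiddenCoinsBound 4 (3 / 4)

/-- Monotonicity in `m` is immediate from the definition. [bookkeeping] -/
theorem hiddenCoinsBound_mono {m m' : ℕ} {θ : ℝ} (h : HiddenCoinsBound m θ) (hm : m ≤ m') :
    HiddenCoinsBound m' θ :=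
  fun n c J hJ y hy => h n c J (by omega) y hy

/-- J_4 from the two pieces. [bookkeeping] -/
theorem hiddenCoinsFour_of (hred : HiddenCoinsReduction) : HiddenCoinsFour := by
  have h := hred 4 12 FreePhase.bound_four
  have : ((12 : ℕ) : ℝ) / (2 : ℝ) ^ 4 = 3 / 4 := by norm_num
  rw [this] at h
  exact h


end Summit.QuantumAdvantage.AdviceFreeQNC0
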